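import Literature.Topology.FourManifolds.FibrewiseMorseFrame
import Mathlib.Analysis.Calculus.InverseFunctionTheorem.ContDiff
import HarnessLib

/-!
# The inverse function theorem along a periodic family of zeros (fibred local inverse)

Topic `Literature/Topology/FourManifolds` (analytic groundwork, brick F6a of the fact seat's
plan for `nonempty_diffeomorph_sphere_four_of_sblf_genus_one_noLefschetz`): the last step of the
Morse–Bott tube of a circle of nondegenerate critical points inverts the fibrewise Morse
coordinates `u ↦ y (t, u)` of `Splitting.exists_periodic_fibrewiseMorseCoords_of_frame`
(`FibrewiseMorseFrame.lean`) uniformly and periodically in the parameter `t`.  Everything here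
is **proved**; there are no definitions and no named facts.

* `Splitting.exists_fibred_localInverse` — **the inverse function theorem with a periodic
  parameter.**  Let `y : ℝ × V → V` (`V` a Banach space) be `C^∞` on a tube `ℝ × B(0, r)`,
  `T`-periodic in `t`, with `y (t, 0) = 0` and invertible fibre derivative `∂ᵤ y (t, 0)` for every
  `t`.  Then there are `0 < ε ≤ r`, `ρ > 0` and `x : ℝ × V → V`, `C^∞` on `ℝ × B(0, ρ)`,
  `T`-periodic, `x (t, 0) = 0`, with `x (t, w) ∈ B(0, ε)` and `y (t, x (t, w)) = w` for
  `‖w‖ < ρ`, and `u ↦ y (t, u)` injective on `B(0, ε)` for every `t` — so that on the tube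
  `ℝ × B(0, ρ)` the map `(t, w) ↦ (t, x (t, w))` is the inverse of `(t, u) ↦ (t, y (t, u))`.
  (Dieudonné 1960, (10.2.5) and (10.3.1): the inverse function theorem and its dependence on a
  parameter; Hirsch 1976, Ch. 4 §5, the uniform tube of the tubular neighbourhood theorem.  The
  proof: `Φ (t, u) = (t, y (t, u))` has invertible derivative along the zero section, is
  injective on a uniform tube by a periodic Lebesgue-number argument, hence a diffeomorphism of
  the tube onto an open periodic neighbourhood of the zero section, which contains a uniform
  tube.)

## References

* J. Dieudonné, *Foundations of Modern Analysis* (1960), (10.2.5), (10.3.1). [Dieudonne1960]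
* M. W. Hirsch, *Differential Topology*, GTM 33 (1976), Ch. 4 §5. [HirschDT1976]
-/

noncomputable section

open Set Function Filter Metric
open scoped Topology ContDiff

namespace Literature.Topology.FourManifolds

namespace Splitting

variable {V : Type*} [NormedAddCommGroup V] [NormedSpace ℝ V] [CompleteSpace V]

/-- A `T`-periodic function is `ℤT`-periodic. [folklore] -/
theorem apply_add_int_mul_eq {W : Type*} {g : ℝ → W} {T : ℝ} (hgT : ∀ t : ℝ, g (t + T) = g t)
    (t : ℝ) (k : ℤ) : g (t + k * T) = g t := by
  induction k using Int.induction_on generalizing t with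
  | zero => simp
  | succ n ih =>
    have h1 : t + ((n : ℤ) + 1 : ℤ) * T = (t + ((n : ℤ) : ℝ) * T) + T := by push_cast; ring
    rw [h1, hgT, ih t]
  | pred n ih =>
    have h1 : t + (-(n : ℤ) - 1 : ℤ) * T = (t - T) + (-(n : ℤ) : ℤ) * T := by push_cast; ring
    rw [h1, ih (t - T)]
    have h2 := hgT (t - T)
    rw [sub_add_cancel] at h2
    exact h2.symm

omit [CompleteSpace V] in
/-- The derivative of the fibred map `Φ (t, u) = (t, y (t, u))`: if `∂ᵤ y` is invertible at `q`
then `DΦ (q)` is a linear automorphism of `ℝ × V`. [folklore] -/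
theorem exists_equiv_fderiv_prodMk {y : ℝ × V → V} {q : ℝ × V} (hy : DifferentiableAt ℝ y q)
    (E : V ≃L[ℝ] V) (hE : (E : V →L[ℝ] V) = (fderiv ℝ y q).comp (ContinuousLinearMap.inr ℝ ℝ V)) :
    ∃ L : (ℝ × V) ≃L[ℝ] (ℝ × V),
      HasFDerivAt (fun q : ℝ × V => (q.1, y q)) (L : ℝ × V →L[ℝ] ℝ × V) q := by
  obtain ⟨A, hA⟩ : ∃ A : ℝ × V →L[ℝ] ℝ × V,
      A = (ContinuousLinearMap.fst ℝ ℝ V).prod (fderiv ℝ y q) := ⟨_, rfl⟩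
  obtain ⟨B, hB⟩ : ∃ B : ℝ × V →L[ℝ] ℝ × V,
      B = (ContinuousLinearMap.fst ℝ ℝ V).prod ((E.symm : V →L[ℝ] V).comp
        (ContinuousLinearMap.snd ℝ ℝ V - ((fderiv ℝ y q).comp (ContinuousLinearMap.inl ℝ ℝ V)).comp
          (ContinuousLinearMap.fst ℝ ℝ V))) := ⟨_, rfl⟩
  have hEa : ∀ a : V, E a = fderiv ℝ y q ((0 : ℝ), a) := fun a => by
    have := congrArg (fun f : V →L[ℝ] V => f a) hE
    simpa using this
  have hsplit : ∀ (s : ℝ) (a : V), fderiv ℝ y q (s, a) =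
      fderiv ℝ y q (s, (0 : V)) + E a := fun s a => by
    rw [hEa, ← map_add, Prod.mk_add_mk, add_zero, zero_add]
  have hA_apply : ∀ p : ℝ × V, A p = (p.1, fderiv ℝ y q p) := fun p => by rw [hA]; rfl
  have hB_apply : ∀ p : ℝ × V, B p = (p.1, E.symm (p.2 - fderiv ℝ y q (p.1, (0 : V)))) :=
    fun p => by rw [hB]; rfl
  have h₁ : ∀ p, B (A p) = p := by
    rintro ⟨s, a⟩
    rw [hA_apply, hB_apply]
    dsimp only
    rw [hsplit s a, add_sub_cancel_left, E.symm_apply_apply]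
  have h₂ : ∀ p, A (B p) = p := by
    rintro ⟨s, b⟩
    rw [hB_apply, hA_apply]
    dsimp only
    rw [hsplit, E.apply_symm_apply, add_sub_cancel]
  refine ⟨ContinuousLinearEquiv.equivOfInverse A B h₁ h₂, ?_⟩
  have hd : HasFDerivAt (fun q : ℝ × V => (q.1, y q)) A q := by
    rw [hA]
    exact hasFDerivAt_fst.prodMk hy.hasFDerivAt
  exact hd

/-- **The inverse function theorem with a periodic parameter (fibred local inverse along a
periodic family of zeros).** [cite: Dieudonne1960, (10.2.5), (10.3.1)]
[cite: HirschDT1976, Ch. 4 §5] -/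
theorem exists_fibred_localInverse {y : ℝ × V → V} {r T : ℝ} (hr : 0 < r) (hT : 0 < T)
    (hys : ContDiffOn ℝ ∞ y (univ ×ˢ ball (0 : V) r))
    (hyT : ∀ (t : ℝ) (u : V), y (t + T, u) = y (t, u)) (hy0 : ∀ t : ℝ, y (t, 0) = 0)
    (hyd : ∀ t : ℝ, ∃ D : V ≃L[ℝ] V, HasFDerivAt (fun u : V => y (t, u)) (D : V →L[ℝ] V) 0) :
    ∃ (ε ρ : ℝ) (x : ℝ × V → V), 0 < ε ∧ ε ≤ r ∧ 0 < ρ ∧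
      ContDiffOn ℝ ∞ x (univ ×ˢ ball (0 : V) ρ) ∧
      (∀ (t : ℝ) (w : V), x (t + T, w) = x (t, w)) ∧ (∀ t : ℝ, x (t, 0) = 0) ∧
      (∀ (t : ℝ) (w : V), w ∈ ball (0 : V) ρ → x (t, w) ∈ ball (0 : V) ε ∧ y (t, x (t, w)) = w) ∧
      ∀ t : ℝ, InjOn (fun u : V => y (t, u)) (ball (0 : V) ε) := by
  -- the tube `S = ℝ × B(0, r)` and the fibred map `Φ`
  have hSo : IsOpen ((univ : Set ℝ) ×ˢ ball (0 : V) r) := isOpen_univ.prod isOpen_ball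
  have hmemS : ∀ {t : ℝ} {u : V}, ((t, u) : ℝ × V) ∈ (univ : Set ℝ) ×ˢ ball (0 : V) r ↔
      u ∈ ball (0 : V) r := fun {t} {u} => by simp [mem_prod]
  obtain ⟨Φ, hΦ⟩ : ∃ Φ : ℝ × V → ℝ × V, Φ = fun q => (q.1, y q) := ⟨_, rfl⟩
  have hΦ_apply : ∀ q, Φ q = (q.1, y q) := fun q => by rw [hΦ]
  have hΦs : ContDiffOn ℝ ∞ Φ ((univ : Set ℝ) ×ˢ ball (0 : V) r) := by
    rw [hΦ]; exact contDiffOn_fst.prodMk hys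
  have hyat : ∀ q ∈ (univ : Set ℝ) ×ˢ ball (0 : V) r, ContDiffAt ℝ ∞ y q := fun q hq =>
    hys.contDiffAt (hSo.mem_nhds hq)
  have hΦat : ∀ q ∈ (univ : Set ℝ) ×ˢ ball (0 : V) r, ContDiffAt ℝ ∞ Φ q := fun q hq =>
    hΦs.contDiffAt (hSo.mem_nhds hq)
  -- periodicity of `y`, of its derivative, of `Φ`
  have hyT' : ∀ (t : ℝ) (u : V) (k : ℤ), y (t + k * T, u) = y (t, u) := fun t u k =>
    apply_add_int_mul_eq (g := fun s => y (s, u)) (fun s => hyT s u) t k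
  have hfdT : ∀ (t : ℝ) (u : V), fderiv ℝ y (t + T, u) = fderiv ℝ y (t, u) := fun t u => by
    have hfun : (fun q : ℝ × V => y (q + ((T : ℝ), (0 : V)))) = y := funext fun q => by
      obtain ⟨a, b⟩ := q
      show y (a + T, b + 0) = y (a, b)
      rw [add_zero, hyT]
    have e : ((t + T, u) : ℝ × V) = (t, u) + (T, 0) := by rw [Prod.mk_add_mk, add_zero]
    rw [e, ← fderiv_comp_add_right ((T : ℝ), (0 : V)), hfun]
  /- Step 1: invertibility of the fibre derivative on a uniform tube `ℝ × B(0, ε₁)`. -/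
  obtain ⟨Dfib, hDfib⟩ : ∃ Dfib : ℝ × V → (V →L[ℝ] V),
      Dfib = fun q => (fderiv ℝ y q).comp (ContinuousLinearMap.inr ℝ ℝ V) := ⟨_, rfl⟩
  have hDfib_apply : ∀ q a, Dfib q a = fderiv ℝ y q ((0 : ℝ), a) := fun q a => by
    rw [hDfib]; rfl
  have hDc : ContinuousOn Dfib ((univ : Set ℝ) ×ˢ ball (0 : V) r) := by
    rw [hDfib]
    have h1 : ContinuousOn (fderiv ℝ y) ((univ : Set ℝ) ×ˢ ball (0 : V) r) :=
      hys.continuousOn_fderiv_of_isOpen hSo (by simp)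
    exact ((ContinuousLinearMap.compL ℝ V (ℝ × V) V).flip
      (ContinuousLinearMap.inr ℝ ℝ V)).continuous.comp_continuousOn h1
  obtain ⟨W₁, hW₁⟩ : ∃ W₁ : Set (ℝ × V), W₁ = ((univ : Set ℝ) ×ˢ ball (0 : V) r) ∩
      Dfib ⁻¹' range ((↑) : (V ≃L[ℝ] V) → V →L[ℝ] V) := ⟨_, rfl⟩
  have hW₁o : IsOpen W₁ := by
    rw [hW₁]; exact hDc.isOpen_inter_preimage hSo ContinuousLinearEquiv.isOpen
  have hW₁0 : ∀ t : ℝ, ((t, (0 : V)) : ℝ × V) ∈ W₁ := by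
    intro t
    rw [hW₁]
    refine ⟨hmemS.2 (mem_ball_self hr), ?_⟩
    obtain ⟨D, hD⟩ := hyd t
    refine ⟨D, ?_⟩
    -- `∂ᵤ y (t, 0) = D`
    have h1 : HasFDerivAt (fun u : V => y (t, u)) (Dfib (t, 0)) 0 := by
      rw [hDfib]
      have hya : HasFDerivAt y (fderiv ℝ y (t, 0)) ((fun u : V => ((t, u) : ℝ × V)) 0) :=
        ((hyat _ (hmemS.2 (mem_ball_self hr))).differentiableAt (by simp)).hasFDerivAt
      have hi : HasFDerivAt (fun u : V => ((t, u) : ℝ × V)) (ContinuousLinearMap.inr ℝ ℝ V) 0 :=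
        (hasFDerivAt_const t 0).prodMk (hasFDerivAt_id 0)
      exact hya.comp 0 hi
    exact hD.unique h1 ▸ rfl
  have hW₁T : ∀ (t : ℝ) (u : V), ((t, u) : ℝ × V) ∈ W₁ → ((t + T, u) : ℝ × V) ∈ W₁ := by
    intro t u h
    rw [hW₁] at h ⊢
    refine ⟨hmemS.2 (hmemS.1 h.1), ?_⟩
    have h2 := h.2
    simp only [mem_preimage] at h2 ⊢
    rw [hDfib] at h2 ⊢
    simpa only [hfdT] using h2
  have hW₁T' : ∀ (t : ℝ) (u : V), ((t, u) : ℝ × V) ∈ W₁ → ((t - T, u) : ℝ × V) ∈ W₁ := by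
    intro t u h
    rw [hW₁] at h ⊢
    refine ⟨hmemS.2 (hmemS.1 h.1), ?_⟩
    have h2 := h.2
    simp only [mem_preimage] at h2 ⊢
    rw [hDfib] at h2 ⊢
    have h3 := hfdT (t - T) u
    rw [sub_add_cancel] at h3
    simpa only [h3] using h2
  obtain ⟨ε₁, hε₁, hball₁⟩ := exists_ball_subset_of_forall_add hW₁o hW₁0 hT hW₁T hW₁T'
  -- at points of `W₁`: an invertible derivative of `Φ`
  have hΦd : ∀ q ∈ W₁, ∃ L : (ℝ × V) ≃L[ℝ] (ℝ × V),
      HasFDerivAt Φ (L : ℝ × V →L[ℝ] ℝ × V) q := by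
    intro q hq
    rw [hW₁] at hq
    obtain ⟨hqS, E, hE⟩ := hq
    have hE' : (E : V →L[ℝ] V) = (fderiv ℝ y q).comp (ContinuousLinearMap.inr ℝ ℝ V) := by
      rw [hE, hDfib]
    obtain ⟨L, hL⟩ := exists_equiv_fderiv_prodMk
      ((hyat q hqS).differentiableAt (by simp)) E hE'
    exact ⟨L, by rw [hΦ]; exact hL⟩
  /- Step 2: injectivity on a uniform tube `ℝ × B(0, ε₂)` (periodic Lebesgue-number argument). -/
  -- local injectivity near each point of the zero section
  have hloc : ∀ t : ℝ, ∃ U : Set (ℝ × V), IsOpen U ∧ ((t, (0 : V)) : ℝ × V) ∈ U ∧ InjOn Φ U := by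
    intro t
    obtain ⟨L, hL⟩ := hΦd (t, 0) (hW₁0 t)
    have hc : ContDiffAt ℝ ∞ Φ (t, 0) := hΦat _ (hmemS.2 (mem_ball_self hr))
    refine ⟨(hc.toOpenPartialHomeomorph Φ hL (by simp)).source,
      (hc.toOpenPartialHomeomorph Φ hL (by simp)).open_source,
      hc.mem_toOpenPartialHomeomorph_source hL (by simp), ?_⟩
    have := (hc.toOpenPartialHomeomorph Φ hL (by simp)).injOn
    rwa [ContDiffAt.toOpenPartialHomeomorph_coe] at this
  choose U hUo hU0 hUinj using hloc
  -- the open set of good pairs, periodised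
  obtain ⟨O, hO⟩ : ∃ O : Set (ℝ × (V × V)), O = {p | ∃ (k : ℤ) (s : ℝ),
      ((p.1 + k * T, p.2.1) : ℝ × V) ∈ U s ∧ ((p.1 + k * T, p.2.2) : ℝ × V) ∈ U s} := ⟨_, rfl⟩
  have hOo : IsOpen O := by
    have : O = ⋃ (k : ℤ) (s : ℝ), {p : ℝ × (V × V) |
        ((p.1 + k * T, p.2.1) : ℝ × V) ∈ U s ∧ ((p.1 + k * T, p.2.2) : ℝ × V) ∈ U s} := by
      rw [hO]; ext p; simp
    rw [this]
    refine isOpen_iUnion fun k => isOpen_iUnion fun s => ?_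
    refine ((hUo s).preimage (by fun_prop)).inter ((hUo s).preimage (by fun_prop))
  have hO0 : ∀ t : ℝ, ((t, ((0 : V), (0 : V))) : ℝ × (V × V)) ∈ O := fun t => by
    rw [hO]; exact ⟨0, t, by simpa using hU0 t, by simpa using hU0 t⟩
  have hOT : ∀ (t : ℝ) (p : V × V), ((t, p) : ℝ × (V × V)) ∈ O →
      ((t + T, p) : ℝ × (V × V)) ∈ O := by
    intro t p h
    rw [hO] at h ⊢
    obtain ⟨k, s, h1, h2⟩ := h
    refine ⟨k - 1, s, ?_, ?_⟩
    · have e : t + T + ((k - 1 : ℤ) : ℝ) * T = t + k * T := by push_cast; ring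
      simpa only [e] using h1
    · have e : t + T + ((k - 1 : ℤ) : ℝ) * T = t + k * T := by push_cast; ring
      simpa only [e] using h2
  have hOT' : ∀ (t : ℝ) (p : V × V), ((t, p) : ℝ × (V × V)) ∈ O →
      ((t - T, p) : ℝ × (V × V)) ∈ O := by
    intro t p h
    rw [hO] at h ⊢
    obtain ⟨k, s, h1, h2⟩ := h
    refine ⟨k + 1, s, ?_, ?_⟩
    · have e : t - T + ((k + 1 : ℤ) : ℝ) * T = t + k * T := by push_cast; ring
      simpa only [e] using h1
    · have e : t - T + ((k + 1 : ℤ) : ℝ) * T = t + k * T := by push_cast; ring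
      simpa only [e] using h2
  have hOgood : ∀ (t : ℝ) (u u' : V), ((t, (u, u')) : ℝ × (V × V)) ∈ O →
      y (t, u) = y (t, u') → u = u' := by
    intro t u u' h hy
    rw [hO] at h
    obtain ⟨k, s, h1, h2⟩ := h
    have heq : Φ (t + k * T, u) = Φ (t + k * T, u') := by
      rw [hΦ_apply, hΦ_apply]
      dsimp only
      rw [hyT' t u k, hyT' t u' k, hy]
    have := hUinj s h1 h2 heq
    exact (Prod.mk.inj this).2
  obtain ⟨ε₂, hε₂, hball₂⟩ := exists_ball_subset_of_forall_add hOo hO0 hT hOT hOT'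
  have hinj₂ : ∀ t : ℝ, InjOn (fun u : V => y (t, u)) (ball (0 : V) ε₂) := by
    intro t u hu u' hu' hy
    refine hOgood t u u' (hball₂ t (u, u') ?_) hy
    rw [mem_ball_zero_iff] at hu hu' ⊢
    exact max_lt hu hu'   -- `‖(u, u')‖ = max ‖u‖ ‖u'‖`
  /- Step 3: the tube `Ω = ℝ × B(0, ε)` and the homeomorphism `Φ|Ω`. -/
  obtain ⟨ε, hε⟩ : ∃ ε : ℝ, ε = min (min ε₁ ε₂) r := ⟨_, rfl⟩
  have hεpos : 0 < ε := by rw [hε]; positivity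
  have hε₁' : ε ≤ ε₁ := by rw [hε]; exact (min_le_left _ _).trans (min_le_left _ _)
  have hε₂' : ε ≤ ε₂ := by rw [hε]; exact (min_le_left _ _).trans (min_le_right _ _)
  have hεr : ε ≤ r := by rw [hε]; exact min_le_right _ _
  obtain ⟨Ω, hΩ⟩ : ∃ Ω : Set (ℝ × V), Ω = (univ : Set ℝ) ×ˢ ball (0 : V) ε := ⟨_, rfl⟩
  have hmemΩ : ∀ {t : ℝ} {u : V}, ((t, u) : ℝ × V) ∈ Ω ↔ u ∈ ball (0 : V) ε := fun {t} {u} => by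
    rw [hΩ]; simp [mem_prod]
  have hΩo : IsOpen Ω := by rw [hΩ]; exact isOpen_univ.prod isOpen_ball
  have hΩW : Ω ⊆ W₁ := by
    rintro ⟨t, u⟩ h
    exact hball₁ t u (ball_subset_ball hε₁' (hmemΩ.1 h))
  have hΩS : Ω ⊆ (univ : Set ℝ) ×ˢ ball (0 : V) r := by
    rintro ⟨t, u⟩ h
    exact hmemS.2 (ball_subset_ball hεr (hmemΩ.1 h))
  have hinjΩ : InjOn Φ Ω := by
    rintro ⟨t, u⟩ hq ⟨t', u'⟩ hq' heq
    rw [hΦ_apply, hΦ_apply] at heq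
    obtain ⟨h1, h2⟩ := Prod.mk.inj heq
    dsimp only at h1 h2
    subst h1
    have := hinj₂ t (ball_subset_ball hε₂' (hmemΩ.1 hq)) (ball_subset_ball hε₂' (hmemΩ.1 hq')) h2
    rw [this]
  -- `Φ|Ω` is open
  have hnhds : ∀ q ∈ Ω, map Φ (𝓝 q) = 𝓝 (Φ q) := by
    intro q hq
    obtain ⟨L, hL⟩ := hΦd q (hΩW hq)
    exact ((hΦat q (hΩS hq)).hasStrictFDerivAt' hL (by simp)).map_nhds_eq_of_equiv
  have hopen : IsOpenMap (Ω.restrict Φ) := by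
    rw [isOpenMap_iff_nhds_le]
    rintro ⟨q, hq⟩
    have h1 : map (Ω.restrict Φ) (𝓝 ⟨q, hq⟩) = map Φ (𝓝 q) := by
      rw [show Ω.restrict Φ = Φ ∘ Subtype.val from rfl, ← Filter.map_map, map_nhds_subtype_val,
        hΩo.nhdsWithin_eq hq]
    rw [restrict_apply, h1, hnhds q hq]
  -- the homeomorphism `H = Φ|Ω : Ω ≃ Φ(Ω)`
  obtain ⟨H, hHcoe, hHsrc, hHtgt⟩ : ∃ H : OpenPartialHomeomorph (ℝ × V) (ℝ × V),
      (H : ℝ × V → ℝ × V) = Φ ∧ H.source = Ω ∧ H.target = Φ '' Ω :=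
    ⟨OpenPartialHomeomorph.ofContinuousOpenRestrict (hinjΩ.toPartialEquiv Φ Ω)
      (hΦs.continuousOn.mono hΩS) hopen hΩo, rfl, rfl, rfl⟩
  /- Step 4: the image `Φ(Ω)` is an open periodic neighbourhood of the zero section, so it
  contains a uniform tube `ℝ × B(0, ρ)`. -/
  have hIo : IsOpen (Φ '' Ω) := hHtgt ▸ H.open_target
  have hI0 : ∀ t : ℝ, ((t, (0 : V)) : ℝ × V) ∈ Φ '' Ω := fun t =>
    ⟨(t, 0), hmemΩ.2 (mem_ball_self hεpos), by rw [hΦ_apply, hy0]⟩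
  have hIT : ∀ (t : ℝ) (w : V), ((t, w) : ℝ × V) ∈ Φ '' Ω → ((t + T, w) : ℝ × V) ∈ Φ '' Ω := by
    rintro t w ⟨⟨s, u⟩, hu, he⟩
    rw [hΦ_apply] at he
    obtain ⟨h1, h2⟩ := Prod.mk.inj he
    dsimp only at h1 h2
    subst h1
    exact ⟨(s + T, u), hmemΩ.2 (hmemΩ.1 hu), by rw [hΦ_apply, hyT, h2]⟩
  have hIT' : ∀ (t : ℝ) (w : V), ((t, w) : ℝ × V) ∈ Φ '' Ω → ((t - T, w) : ℝ × V) ∈ Φ '' Ω := by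
    rintro t w ⟨⟨s, u⟩, hu, he⟩
    rw [hΦ_apply] at he
    obtain ⟨h1, h2⟩ := Prod.mk.inj he
    dsimp only at h1 h2
    subst h1
    refine ⟨(s - T, u), hmemΩ.2 (hmemΩ.1 hu), ?_⟩
    have h3 := hyT (s - T) u
    rw [sub_add_cancel] at h3
    rw [hΦ_apply, ← h3, h2]
  obtain ⟨ρ, hρ, hballρ⟩ := exists_ball_subset_of_forall_add hIo hI0 hT hIT hIT'
  /- Step 5: the inverse `x₀ (t, w) = (H⁻¹ (t, w)).2` on `Φ(Ω)` and its periodisation `x`. -/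
  obtain ⟨x₀, hx₀⟩ : ∃ x₀ : ℝ × V → V, x₀ = fun p => (H.symm p).2 := ⟨_, rfl⟩
  have hkey : ∀ (t : ℝ) (w : V), ((t, w) : ℝ × V) ∈ Φ '' Ω →
      ((t, x₀ (t, w)) : ℝ × V) ∈ Ω ∧ y (t, x₀ (t, w)) = w := by
    intro t w h
    have ht : ((t, w) : ℝ × V) ∈ H.target := by rw [hHtgt]; exact h
    have h1 : H.symm (t, w) ∈ Ω := hHsrc ▸ H.map_target ht
    have h2 : Φ (H.symm (t, w)) = (t, w) := by rw [← hHcoe]; exact H.right_inv ht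
    rw [hΦ_apply] at h2
    obtain ⟨h21, h22⟩ := Prod.mk.inj h2
    have hpair : H.symm (t, w) = (t, x₀ (t, w)) := by
      rw [hx₀]
      exact Prod.ext h21 rfl
    rw [hpair] at h1 h22
    exact ⟨h1, h22⟩
  have hx₀s : ∀ p ∈ Φ '' Ω, ContDiffAt ℝ ∞ x₀ p := by
    intro p hp
    have ht : p ∈ H.target := by rw [hHtgt]; exact hp
    have h1 : H.symm p ∈ Ω := hHsrc ▸ H.map_target ht
    obtain ⟨L, hL⟩ := hΦd _ (hΩW h1)
    have h2 : ContDiffAt ℝ ∞ H.symm p :=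
      H.contDiffAt_symm ht (by rw [hHcoe]; exact hL) (by rw [hHcoe]; exact hΦat _ (hΩS h1))
    rw [hx₀]
    exact contDiffAt_snd.comp p h2
  have hx₀0 : ∀ t : ℝ, x₀ (t, 0) = 0 := by
    intro t
    have h1 : ((t, (0 : V)) : ℝ × V) ∈ Ω := hmemΩ.2 (mem_ball_self hεpos)
    have h2 : H.symm (Φ (t, 0)) = (t, 0) := by
      rw [← hHcoe]; exact H.left_inv (by rw [hHsrc]; exact h1)
    rw [hΦ_apply, hy0] at h2
    rw [hx₀]
    show (H.symm (t, 0)).2 = 0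
    rw [h2]
  have hx₀T : ∀ (t : ℝ) (w : V), w ∈ ball (0 : V) ρ → x₀ (t + T, w) = x₀ (t, w) := by
    intro t w hw
    obtain ⟨h1, h2⟩ := hkey t w (hballρ t w hw)
    obtain ⟨h3, h4⟩ := hkey (t + T) w (hballρ (t + T) w hw)
    have h5 : ((t + T, x₀ (t, w)) : ℝ × V) ∈ Ω := hmemΩ.2 (hmemΩ.1 h1)
    have heq : Φ (t + T, x₀ (t + T, w)) = Φ (t + T, x₀ (t, w)) := by
      rw [hΦ_apply, hΦ_apply]
      dsimp only
      rw [h4, hyT, h2]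
    exact (Prod.mk.inj (hinjΩ h3 h5 heq)).2
  have hx₀T' : ∀ (t : ℝ) (w : V), w ∈ ball (0 : V) ρ → ∀ k : ℤ, x₀ (t + k * T, w) = x₀ (t, w) :=
    fun t w hw k => apply_add_int_mul_eq (g := fun s => x₀ (s, w)) (fun s => hx₀T s w hw) t k
  obtain ⟨x, hx⟩ : ∃ x : ℝ × V → V, x = fun p => x₀ (toIcoMod hT 0 p.1, p.2) := ⟨_, rfl⟩
  have hxx₀ : ∀ (t : ℝ) (w : V), w ∈ ball (0 : V) ρ → x (t, w) = x₀ (t, w) := by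
    intro t w hw
    rw [hx]
    show x₀ (toIcoMod hT 0 t, w) = x₀ (t, w)
    rw [toIcoMod, zsmul_eq_mul, show t - (toIcoDiv hT 0 t : ℝ) * T =
      t + ((-toIcoDiv hT 0 t : ℤ) : ℝ) * T by push_cast; ring, hx₀T' t w hw]
  have hxT : ∀ (t : ℝ) (w : V), x (t + T, w) = x (t, w) := by
    intro t w
    rw [hx]
    show x₀ (toIcoMod hT 0 (t + T), w) = x₀ (toIcoMod hT 0 t, w)
    rw [toIcoMod_add_right]
  /- Step 6: collect. -/
  refine ⟨ε, ρ, x, hεpos, hεr, hρ, ?_, hxT, fun t => ?_, fun t w hw => ?_, fun t =>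
    (hinj₂ t).mono (ball_subset_ball hε₂')⟩
  · -- smoothness on the tube
    have h1 : ContDiffOn ℝ ∞ x₀ ((univ : Set ℝ) ×ˢ ball (0 : V) ρ) := fun p hp =>
      (hx₀s p (by
        obtain ⟨t, w⟩ := p
        exact hballρ t w (by simpa [mem_prod] using hp))).contDiffWithinAt
    refine h1.congr ?_
    rintro ⟨t, w⟩ hp
    exact hxx₀ t w (by simpa [mem_prod] using hp)
  · rw [hxx₀ t 0 (mem_ball_self hρ), hx₀0]
  · rw [hxx₀ t w hw]
    obtain ⟨h1, h2⟩ := hkey t w (hballρ t w hw)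
    exact ⟨hmemΩ.1 h1, h2⟩

end Splitting

end Literature.Topology.FourManifolds
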